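import Mathlib
import Summits.MatrixMultiplication.Statement
import Summits.MatrixMultiplication.MatrixMultiplication.Theorems.GraphEquationsVerificationExponent
import Summits.MatrixMultiplication.MatrixMultiplication.Theorems.GraphEquationsCubicRung

/-!
# Degree dials: `ω_v ≤ ω₃ ≤ ω₂ = ω`, and `H_mult` split by degree `3` (`GraphEquations`, M53)

Decomp-mm node «GraphEquations» (lens 5 «finite range + asymptotic regime + bridge», g41); attacked
leaf `MultiplicityReduction` (stmt-MatrixMultiplication-27806).  Target VERBATIM:
`_root_.MatrixMultiplication`.  Route-neutral: CURRENCY ONLY (writer G29 (a)(b), G34) — no dial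
vocabulary enters the cut `closes (hV) (hM)`.

* `generatorSystem_isQuadratic`, **`eqAdmissibleQuad_of_omega_lt`** (G29 (a)): the BCS (15.1)
  generator systems have QUADRATIC tests `c_q − Σ_k a_{q₁k} b_{kq₂}`, so every `β > ω` admits cheap
  correct quadratic systems.
* `omegaQuad` (`ω₂ := inf {β | EqAdmissibleQuad β}`) with **`omegaQuad_eq_omega : ω₂ = ω`
  UNCONDITIONALLY** (rung `2` is CLOSED as a dial: `≥` is `reducedAt_zero_of_isQuadratic` +
  `reducedEquationsForceMultiplication_holds`, `≤` is (a)).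
* `omegaCubic` (`ω₃`) with `omegaVerif_le_omegaCubic`, `omegaCubic_le_omega`: the chain
  **`2 ≤ ω_v ≤ ω₃ ≤ ω₂ = ω < 2.48`**.
* The two DEGREE-`3` DIAL STATEMENTS (both NEC, both open, neither uses `ω_v` in its text):
  `CubicEquationsForceMultiplication` («cheap correct cubic systems force cheap multiplication»,
  `↔ ω ≤ ω₃`, `cubicEquationsForceMultiplication_iff`) and `CubicDegreeReduction` («cheap correct
  systems can be made cubic at any larger exponent», `↔ ω₃ ≤ ω_v`, `cubicDegreeReduction_iff`), and the
  EXACT split **`multiplicityReduction_iff_cubic_split : H_mult ↔ CEFM ∧ CDR`** (G29 (b): the cubic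
  cut BY NAME), `matrixMultiplication_iff_cubic_split : S ↔ V ∧ CEFM ∧ CDR`.
* What feeds `CEFM` after g41: NOT rigidity (`C3ₙ` is refuted for `n ≥ 2`, M51b; the bridge
  `cubicEquationsForceMultiplication_of_cubicReduction` below is kept only as the record of a VACUOUS
  implication) but UNMASKING COST: `CubicUnmask C` («every correct cubic system for `W_n` extends to
  a correct generically reduced one at additive cost `C·n²`»; finite algebra, sufficient, NOT known to
  be NEC, UNDECIDED, consistent with every masking the cell knows — M51b unmasks the square masked
  systems with ONE generator) and **`cubicEquationsForceMultiplication_of_cubicUnmask`**.  `CubicUnmask`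
  is in turn fed by the corank dial of M52 (`CorankBound n (C'·n)` + the `k(2n+1)`-gate cost of
  appending `k` generators, g42).
No `sorry`.  Sources: [BurgisserClausenShokrollahi1997, (15.1), Problem 16.3]; [Strassen1973].
-/

-- dupNamespace: forced by the nested Summit.MatrixMultiplication.MatrixMultiplication layout (D-0017)
set_option linter.dupNamespace false

noncomputable section

namespace Summit.MatrixMultiplication.MatrixMultiplication.Theorems.GraphEquations

open Literature.Computability.AlgebraicComplexity
open Literature.Computability.AlgebraicComplexity.ArithCircuit

variable {n : ℕ}

/-! ## (a) Generator systems are quadratic -/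

/-- The entries `Σ_k a_{ik} b_{kl}` of the generic product have total degree `≤ 2`. -/
theorem totalDegree_genericMatMulEntry_le (i l : Fin n) :
    (genericMatMulEntry ℂ n i l).totalDegree ≤ 2 := by
  unfold genericMatMulEntry
  refine (MvPolynomial.totalDegree_finsetSum _ _).trans (Finset.sup_le fun j _ => ?_)
  refine (MvPolynomial.totalDegree_mul _ _).trans ?_
  rw [MvPolynomial.totalDegree_X, MvPolynomial.totalDegree_X]

section

variable (P : ArithCircuit ℂ (MatMulVars n)) (idx : Fin n × Fin n → ℕ)

/-- **The generator system is QUADRATIC**: its tests `c_q − (AB)_q` have total degree `≤ 2`. -/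
theorem generatorSystem_isQuadratic (hidx : ∀ p, idx p < P.size)
    (hval : ∀ p : Fin n × Fin n,
      (gateValues P.gates)[idx p]? = some (genericMatMulEntry ℂ n p.1 p.2)) :
    (generatorSystem P idx).IsQuadratic := by
  intro o
  have hget : (generatorSystem P idx).tests.get o = P.size + ((Fin.cast (generatorSystem_tests_length P idx) o : Fin (n * n)) : ℕ) := by
    show (List.ofFn fun s : Fin (n * n) => P.size + (s : ℕ)).get o = _
    simp
  rw [hget, generatorSystem_testPoly P idx hidx hval]
  refine (MvPolynomial.totalDegree_sub _ _).trans (max_le ?_ ?_)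
  · rw [MvPolynomial.totalDegree_X]
    norm_num
  · exact (MvPolynomial.totalDegree_rename_le _ _).trans (totalDegree_genericMatMulEntry_le _ _)

end

/-- **G29 (a): every `β > ω(ℂ)` admits cheap correct QUADRATIC systems** (compute `AB` fast,
subtract). -/
theorem eqAdmissibleQuad_of_omega_lt {β : ℝ} (hβ : omega ℂ < β) : EqAdmissibleQuad β := by
  obtain ⟨C, hC⟩ := BurgisserClausenShokrollahi1997_prop151_holds ℂ (β - omega ℂ) (sub_pos.2 hβ)
  refine ⟨C + 1, fun n hn => ?_⟩
  obtain ⟨P, hP2, hPc, hPs⟩ := hC n hn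
  have hex : ∀ p : Fin n × Fin n, ∃ j,
      (gateValues P.gates)[j]? = some (genericMatMulEntry ℂ n p.1 p.2) :=
    fun p => List.mem_iff_getElem?.1 (hPc p.1 p.2)
  choose idx hidx using hex
  have hlt : ∀ p, idx p < P.size := fun p => by
    have := (List.getElem?_eq_some_iff.1 (hidx p)).1
    simpa [ArithCircuit.size] using this
  refine ⟨generatorSystem P idx, ⟨generatorSystem_isFanInTwo P idx hP2,
    generatorSystem_zeroSet P idx hlt hidx⟩, generatorSystem_isQuadratic P idx hlt hidx, ?_⟩
  rw [generatorSystem_cost]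
  have hn1 : (1 : ℝ) ≤ n := by exact_mod_cast hn
  have hω2 : (2 : ℝ) ≤ β := (omega_two_le ℂ).trans hβ.le
  have hsq : (n : ℝ) * n ≤ (n : ℝ) ^ β := by
    have h := Real.rpow_le_rpow_of_exponent_le hn1 (show ((2 : ℕ) : ℝ) ≤ β by exact_mod_cast hω2)
    rw [Real.rpow_natCast, sq] at h
    exact h
  have hβeq : omega ℂ + (β - omega ℂ) = β := by ring
  rw [hβeq] at hPs
  push_cast
  linarith

/-- Monotonicity of `EqAdmissibleCubic` in the exponent. -/
theorem EqAdmissibleCubic.mono {β β' : ℝ} (h : EqAdmissibleCubic β) (hββ' : β ≤ β') :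
    EqAdmissibleCubic β' := by
  obtain ⟨c, hc⟩ := h
  refine ⟨max c 0, fun n hn => ?_⟩
  obtain ⟨E, hE, h3, hcost⟩ := hc n hn
  refine ⟨E, hE, h3, hcost.trans ?_⟩
  have hn1 : (1 : ℝ) ≤ n := by exact_mod_cast hn
  have h1 : (n : ℝ) ^ β ≤ (n : ℝ) ^ β' := Real.rpow_le_rpow_of_exponent_le hn1 hββ'
  have h0 : 0 ≤ (n : ℝ) ^ β := Real.rpow_nonneg (by positivity) _
  calc c * (n : ℝ) ^ β ≤ max c 0 * (n : ℝ) ^ β := mul_le_mul_of_nonneg_right (le_max_left c 0) h0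
    _ ≤ max c 0 * (n : ℝ) ^ β' := mul_le_mul_of_nonneg_left h1 (le_max_right c 0)

/-- Every `β > ω` admits cheap correct CUBIC systems. -/
theorem eqAdmissibleCubic_of_omega_lt {β : ℝ} (hβ : omega ℂ < β) : EqAdmissibleCubic β :=
  (eqAdmissibleQuad_of_omega_lt hβ).eqAdmissibleCubic

/-! ## The dials `ω₂`, `ω₃` -/

/-- Admissible exponents of correct QUADRATIC systems. -/
def quadExponents : Set ℝ := {β | EqAdmissibleQuad β}

/-- Admissible exponents of correct CUBIC systems. -/
def cubicExponents : Set ℝ := {β | EqAdmissibleCubic β}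

/-- **`ω₂`**, the quadratic verification exponent. -/
def omegaQuad : ℝ := sInf quadExponents

/-- **`ω₃`**, the cubic verification exponent. -/
def omegaCubic : ℝ := sInf cubicExponents

/-- `quadExponents` is non-empty (`5/2 > ω`). -/
theorem quadExponents_nonempty : quadExponents.Nonempty :=
  ⟨5 / 2, eqAdmissibleQuad_of_omega_lt (lt_trans (BCS1997_cor_15_33 ℂ) (by norm_num))⟩

/-- `cubicExponents` is non-empty. -/
theorem cubicExponents_nonempty : cubicExponents.Nonempty :=
  ⟨5 / 2, eqAdmissibleCubic_of_omega_lt (lt_trans (BCS1997_cor_15_33 ℂ) (by norm_num))⟩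

/-- Quadratic systems are cubic. -/
theorem quadExponents_subset_cubicExponents : quadExponents ⊆ cubicExponents :=
  fun _ h => EqAdmissibleQuad.eqAdmissibleCubic h

/-- Cubic systems are systems. -/
theorem cubicExponents_subset_verifExponents : cubicExponents ⊆ verifExponents :=
  fun _ h => EqAdmissibleCubic.eqAdmissible h

/-- `2` bounds `cubicExponents` from below (M48). -/
theorem two_mem_lowerBounds_cubicExponents : (2 : ℝ) ∈ lowerBounds cubicExponents :=
  fun _ hβ => two_le_of_eqAdmissible (EqAdmissibleCubic.eqAdmissible hβ)

/-- `cubicExponents` is bounded below. -/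
theorem cubicExponents_bddBelow : BddBelow cubicExponents := ⟨2, two_mem_lowerBounds_cubicExponents⟩

/-- `quadExponents` is bounded below. -/
theorem quadExponents_bddBelow : BddBelow quadExponents :=
  cubicExponents_bddBelow.mono quadExponents_subset_cubicExponents

/-- `ω ≤ β` for every quadratically admissible `β` (rung `2`: quadratic ⇒ reduced at `0` ⇒ `H_red`). -/
theorem omega_le_of_mem_quadExponents {β : ℝ} (h : β ∈ quadExponents) : omega ℂ ≤ β :=
  reducedEquationsForceMultiplication_holds β (two_le_of_eqAdmissible (EqAdmissibleQuad.eqAdmissible h))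
    (eqAdmissibleRed_of_eqAdmissibleQuad h)

/-- **`ω₂ = ω` UNCONDITIONALLY** — the quadric dial is closed. -/
theorem omegaQuad_eq_omega : omegaQuad = omega ℂ := by
  refine le_antisymm ?_ (le_csInf quadExponents_nonempty fun β hβ => omega_le_of_mem_quadExponents hβ)
  exact le_of_forall_gt_imp_ge_of_dense fun β hβ =>
    csInf_le quadExponents_bddBelow (eqAdmissibleQuad_of_omega_lt hβ)

/-- `ω₃ ≤ ω₂`. -/
theorem omegaCubic_le_omegaQuad : omegaCubic ≤ omegaQuad :=
  csInf_le_csInf cubicExponents_bddBelow quadExponents_nonempty quadExponents_subset_cubicExponents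

/-- `ω₃ ≤ ω`. -/
theorem omegaCubic_le_omega : omegaCubic ≤ omega ℂ :=
  omegaCubic_le_omegaQuad.trans omegaQuad_eq_omega.le

/-- `ω_v ≤ ω₃`. -/
theorem omegaVerif_le_omegaCubic : omegaVerif ≤ omegaCubic :=
  csInf_le_csInf verifExponents_bddBelow cubicExponents_nonempty cubicExponents_subset_verifExponents

/-- `2 ≤ ω₃`. -/
theorem two_le_omegaCubic : 2 ≤ omegaCubic := two_le_omegaVerif.trans omegaVerif_le_omegaCubic

/-- `ω₃ ≤ β` for every cubically admissible `β`. -/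
theorem omegaCubic_le_of_eqAdmissibleCubic {β : ℝ} (h : EqAdmissibleCubic β) : omegaCubic ≤ β :=
  csInf_le cubicExponents_bddBelow h

/-- Every `β > ω₃` is cubically admissible. -/
theorem eqAdmissibleCubic_of_omegaCubic_lt {β : ℝ} (h : omegaCubic < β) : EqAdmissibleCubic β := by
  obtain ⟨β', hβ', hlt⟩ := exists_lt_of_csInf_lt cubicExponents_nonempty h
  exact EqAdmissibleCubic.mono hβ' hlt.le

/-- **The unconditional chain `2 ≤ ω_v ≤ ω₃ ≤ ω₂ = ω < 2.48`.** -/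
theorem degree_dial_chain :
    2 ≤ omegaVerif ∧ omegaVerif ≤ omegaCubic ∧ omegaCubic ≤ omegaQuad ∧ omegaQuad = omega ℂ ∧
      omega ℂ < 2.48 :=
  ⟨two_le_omegaVerif, omegaVerif_le_omegaCubic, omegaCubic_le_omegaQuad, omegaQuad_eq_omega,
    BCS1997_cor_15_33 ℂ⟩

/-! ## The degree-3 dial statements and the exact split of `H_mult` -/

/-- **CEFM** — cheap correct CUBIC systems force cheap multiplication.  NEC (vacuous-window form under
`S`); open.  After g41 it is fed by UNMASKING COST (`CubicUnmask`), not by rigidity. -/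
def CubicEquationsForceMultiplication : Prop :=
  ∀ β : ℝ, 2 ≤ β → EqAdmissibleCubic β → omega ℂ ≤ β

/-- **CDR** — cubic degree reduction: cheap correct systems can be replaced by cheap correct CUBIC
systems at any larger exponent.  NEC; open. -/
def CubicDegreeReduction : Prop :=
  ∀ β : ℝ, 2 ≤ β → EqAdmissible β → ∀ β' : ℝ, β < β' → EqAdmissibleCubic β'

/-- `CEFM ↔ ω ≤ ω₃` (i.e. `ω₃ = ω`). -/
theorem cubicEquationsForceMultiplication_iff :
    CubicEquationsForceMultiplication ↔ omega ℂ ≤ omegaCubic := by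
  constructor
  · intro h
    exact le_csInf cubicExponents_nonempty fun β hβ =>
      h β (two_le_of_eqAdmissible (EqAdmissibleCubic.eqAdmissible hβ)) hβ
  · intro h β _ hβ
    exact h.trans (omegaCubic_le_of_eqAdmissibleCubic hβ)

/-- `CEFM ↔ ω₃ = ω`. -/
theorem cubicEquationsForceMultiplication_iff_eq :
    CubicEquationsForceMultiplication ↔ omegaCubic = omega ℂ := by
  rw [cubicEquationsForceMultiplication_iff]
  exact ⟨fun h => le_antisymm omegaCubic_le_omega h, fun h => h.ge⟩

/-- `CDR ↔ ω₃ ≤ ω_v` (i.e. `ω₃ = ω_v`). -/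
theorem cubicDegreeReduction_iff : CubicDegreeReduction ↔ omegaCubic ≤ omegaVerif := by
  constructor
  · intro h
    refine le_of_forall_gt_imp_ge_of_dense fun β' hβ' => ?_
    obtain ⟨β, hβ, hββ'⟩ := exists_between hβ'
    exact omegaCubic_le_of_eqAdmissibleCubic
      (h β (two_le_omegaVerif.trans hβ.le) (eqAdmissible_of_omegaVerif_lt hβ) β' hββ')
  · intro h β _ hβ β' hββ'
    exact eqAdmissibleCubic_of_omegaCubic_lt
      (lt_of_le_of_lt (h.trans (omegaVerif_le_of_eqAdmissible hβ)) hββ')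

/-- `CDR ↔ ω₃ = ω_v`. -/
theorem cubicDegreeReduction_iff_eq : CubicDegreeReduction ↔ omegaCubic = omegaVerif := by
  rw [cubicDegreeReduction_iff]
  exact ⟨fun h => le_antisymm h omegaVerif_le_omegaCubic, fun h => h.le⟩

/-- `H_mult ↔ ω ≤ ω_v` (the converse of M49's `omega_le_omegaVerif_of_multiplicityReduction`). -/
theorem multiplicityReduction_iff_omega_le_omegaVerif :
    MultiplicityReduction ↔ omega ℂ ≤ omegaVerif := by
  refine ⟨omega_le_omegaVerif_of_multiplicityReduction, fun h β _ hβ β' hββ' => ?_⟩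
  exact eqAdmissibleRed_of_omega_lt (lt_of_le_of_lt (h.trans (omegaVerif_le_of_eqAdmissible hβ)) hββ')

/-- **G29 (b): the EXACT split of `H_mult` by degree `3`** — `H_mult ↔ CEFM ∧ CDR`. -/
theorem multiplicityReduction_iff_cubic_split :
    MultiplicityReduction ↔ CubicEquationsForceMultiplication ∧ CubicDegreeReduction := by
  rw [multiplicityReduction_iff_omega_le_omegaVerif, cubicEquationsForceMultiplication_iff,
    cubicDegreeReduction_iff]
  have h1 := omegaVerif_le_omegaCubic
  have h2 := omegaCubic_le_omega
  constructor
  · intro h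
    exact ⟨h.trans h1, h2.trans h⟩
  · rintro ⟨ha, hb⟩
    exact ha.trans hb

/-- **The summit, split by degree `3`**: `S ↔ V ∧ CEFM ∧ CDR`. -/
theorem matrixMultiplication_iff_cubic_split :
    _root_.MatrixMultiplication ↔
      GraphEquationsQuadratic ∧ CubicEquationsForceMultiplication ∧ CubicDegreeReduction := by
  rw [← multiplicityReduction_iff_cubic_split, matrixMultiplication_iff_omegaVerif,
    graphEquationsQuadratic_iff_omegaVerif_eq_two, multiplicityReduction_iff_omega_le_omegaVerif]

/-- NEC: `S → CEFM`. -/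
theorem cubicEquationsForceMultiplication_of_matrixMultiplication (hS : _root_.MatrixMultiplication) :
    CubicEquationsForceMultiplication :=
  ((matrixMultiplication_iff_cubic_split.mp hS).2).1

/-- NEC: `S → CDR`. -/
theorem cubicDegreeReduction_of_matrixMultiplication (hS : _root_.MatrixMultiplication) :
    CubicDegreeReduction :=
  ((matrixMultiplication_iff_cubic_split.mp hS).2).2

/-! ## What feeds `CEFM`: unmasking cost, not rigidity -/

/-- The g40 rigidity bridge, kept as a record: `(∀ n, C3ₙ) → CEFM`.  Its hypothesis is REFUTED for
`n ≥ 2` (`not_cubicReduction_all`, M51b): a VACUOUS implication. -/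
theorem cubicEquationsForceMultiplication_of_cubicReduction (h3 : ∀ n, CubicReduction n) :
    CubicEquationsForceMultiplication :=
  fun _ hβ h => omega_le_of_eqAdmissibleCubic h3 hβ h

/-- **`CubicUnmask C`** — every correct cubic system for `W_n` extends to a correct GENERICALLY
REDUCED system at additive cost `≤ C·n²`.  Finite algebra (one statement per system), sufficient for
`CEFM`; UNDECIDED; consistent with all maskings known to the cell (the square masked systems of M51a
unmask with ONE generator, M51b; corank-`k` maskings with `k(2n+1)` gates, M52 + NODE-g41 §3). -/
def CubicUnmask (C : ℕ) : Prop :=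
  ∀ n : ℕ, ∀ E : EqSystem n, E.Correct → E.IsCubic →
    ∃ E' : EqSystem n, E'.Correct ∧ E'.GenericallyReduced ∧ E'.cost ≤ E.cost + C * (n * n)

/-- Under `CubicUnmask C`, cubic admissibility gives reduced admissibility at the SAME exponent. -/
theorem eqAdmissibleRed_of_cubicUnmask {C : ℕ} (hU : CubicUnmask C) {β : ℝ}
    (h : EqAdmissibleCubic β) : EqAdmissibleRed β := by
  have hβ : 2 ≤ β := two_le_of_eqAdmissible h.eqAdmissible
  obtain ⟨c, hc⟩ := h
  refine ⟨c + C, fun n hn => ?_⟩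
  obtain ⟨E, hE, h3, hcost⟩ := hc n hn
  obtain ⟨E', hE', hred, hcost'⟩ := hU n E hE h3
  refine ⟨E', hE', hred, ?_⟩
  have hn1 : (1 : ℝ) ≤ n := by exact_mod_cast hn
  have hsq : (n : ℝ) * n ≤ (n : ℝ) ^ β := by
    have h := Real.rpow_le_rpow_of_exponent_le hn1 (show ((2 : ℕ) : ℝ) ≤ β by exact_mod_cast hβ)
    rw [Real.rpow_natCast, sq] at h
    exact h
  have hcast : (E'.cost : ℝ) ≤ E.cost + C * ((n : ℝ) * n) := by exact_mod_cast hcost'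
  have hC0 : (0 : ℝ) ≤ C := Nat.cast_nonneg C
  nlinarith

/-- **`CubicUnmask C → CEFM`**: the honest mechanism of rung `3` after g41. -/
theorem cubicEquationsForceMultiplication_of_cubicUnmask {C : ℕ} (hU : CubicUnmask C) :
    CubicEquationsForceMultiplication :=
  fun β hβ h => reducedEquationsForceMultiplication_holds β hβ (eqAdmissibleRed_of_cubicUnmask hU h)

end Summit.MatrixMultiplication.MatrixMultiplication.Theorems.GraphEquations

end
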